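import Mathlib
import Literature.Analysis.FluidPDE.ClassicalSolution
import Literature.Analysis.FluidPDE.LerayHopf
import Literature.Analysis.FluidPDE.SuitableWeak
import Literature.Analysis.FluidPDE.LocalTypeI
import Literature.Analysis.FluidPDE.CKN1982Setting
import Literature.Analysis.FluidPDE.ClassicalSuitable
import Literature.Analysis.FluidPDE.NSViscosityRescaling
import Literature.Analysis.FluidPDE.NSLerayHopfABCScaling
import Literature.Analysis.FluidPDE.ClassicalTopPointCubic
import Literature.Analysis.FluidPDE.LerayHopfSpatialGradient
import Literature.Analysis.FluidPDE.NSSuitableESSProofs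
import Literature.Analysis.FluidPDE.Seregin2020ScaledEnergyBounds
import Summits.NavierStokesRegularity.NavierStokesRegularity.Theses.RootDecompStaticSkirt
import Summits.NavierStokesRegularity.NavierStokesRegularity.Theorems.EulerZoomLiouvilleSereginZoomReduction

/-!
# N25's ENGINE LINE `EngineKillsConicalJolt` (item 33329) PROVED: X_E ∧ GX ⟹ LJᶜ through the proved Euler zoom

Route `RootDecompStaticSkirt` (decomp-ns node N25, rev 1), support item `EngineKillsConicalJolt` (stmt-33329):
`X_E → ConicalSkirtFluxGauge → NoTameConicalJoltingSkirt`, where X_E is the S-free Euler-gauge Liouville engine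
`EulerZoomLiouville.PowerGaugeEulerLiouville` (stmt-19832, open; inlined verbatim in the item), GX = `ConicalSkirtFluxGauge`
(stmt-33328) and LJᶜ = `NoTameConicalJoltingSkirt` (stmt-33319, the tame-conical cell of the jolting-skirt residual LJ).

Mechanism (lens-6 g14 «THE EULER GAUGE», kernel `OnsagerEdge.lean` §5/§6, sha256 68ec0ffab7f5…; decomp-ns CRITIC-LEDGER rows
142/150/163 CLEARED): at a tame-conical jolting supercritical skirt vertex `x₀` with exponent `a ∈ (1, 3/2]`,
* K1 `aGauge_of_temperedAt`: temperedness (conical upper envelope of the terminal slice + temperate jolt on the last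
  parabolic windows) gives Seregin's A-gauge `ρ^(2(a−1)) A(ρ) ≤ const` for the normalised solution `v = ν⁻¹u(·/ν)`;
* K2 `cubicFloor_of_flooredAlong`: flooredness (conical lower envelope along the scar sequence + non-evacuation on the last
  advective window) gives the cubic floor (Seregin 2026 (3.1)) along radii `→ 0`, by Hölder on balls;
* GX supplies suitability and the E- and D-gauges at the skirt's exponent; the PROVED zoom
  `Theorems.SereginZoomReduction.sereginZoomReduction_proof` (item Z 19834; Seregin 2026 Thm 3.1 at the power weight,
  arXiv:2507.08733; Seregin 2023 Prop 1.2, arXiv:2210.03215) rescales to a member of X_E's class with gauge `ρ = a − 1 ∈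
  (0, 1/2]` that is not a.e. zero — contradicting X_E.
-/

noncomputable section

namespace Summit.NavierStokesRegularity.NavierStokesRegularity.Theorems.RootDecompStaticSkirtEngineKill

open scoped Topology ENNReal NNReal InnerProductSpace RealInnerProductSpace
open Filter Set MeasureTheory Metric Function
open Literature.Analysis.FluidPDE

/-! ## §5 Analytic kernel: gauge inheritance -/

/-- `‖a‖² ≤ 2‖a − b‖² + 2‖b‖²` in `ℝ≥0∞` form. [folklore] -/
private theorem enorm_sq_le_two {E : Type*} [NormedAddCommGroup E] (a b : E) :
    ‖a‖ₑ ^ 2 ≤ 2 * ‖a - b‖ₑ ^ 2 + 2 * ‖b‖ₑ ^ 2 := by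
  have h : ‖a‖ ^ 2 ≤ 2 * ‖a - b‖ ^ 2 + 2 * ‖b‖ ^ 2 := by
    nlinarith [norm_le_insert' a b, sq_nonneg (‖a - b‖ - ‖b‖), norm_nonneg (a - b), norm_nonneg b, norm_nonneg a]
  have e1 : ‖a‖ₑ ^ 2 = ENNReal.ofReal (‖a‖ ^ 2) := by rw [← ofReal_norm, ENNReal.ofReal_pow (norm_nonneg _)]
  have e2 : ‖a - b‖ₑ ^ 2 = ENNReal.ofReal (‖a - b‖ ^ 2) := by rw [← ofReal_norm, ENNReal.ofReal_pow (norm_nonneg _)]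
  have e3 : ‖b‖ₑ ^ 2 = ENNReal.ofReal (‖b‖ ^ 2) := by rw [← ofReal_norm, ENNReal.ofReal_pow (norm_nonneg _)]
  rw [e1, e2, e3, ← ENNReal.ofReal_ofNat 2, ← ENNReal.ofReal_mul (by norm_num), ← ENNReal.ofReal_mul (by norm_num),
    ← ENNReal.ofReal_add (by positivity) (by positivity)]
  exact ENNReal.ofReal_le_ofReal h

/-- **Generic A-gauge**: a scale-wise window bound `∫_{B_r}‖v t‖² ≤ B r^{1−2ρ}` on the last parabolic windows gives
Seregin's `r^{2ρ} A(r) ≤ B`. [folklore bookkeeping on `cknA`] -/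
theorem aGauge_of_window {v : ℝ → EuclideanSpace ℝ (Fin 3) → EuclideanSpace ℝ (Fin 3)} {t₀ : ℝ}
    {x₀ : EuclideanSpace ℝ (Fin 3)} {ρ r₀ B : ℝ} (_hB : 0 ≤ B)
    (hwin : ∀ r ∈ Set.Ioc 0 r₀, ∀ t ∈ Set.Ioo (t₀ - r ^ 2) t₀,
      ∫⁻ x in ball x₀ r, ‖v t x‖ₑ ^ 2 ≤ ENNReal.ofReal (B * r ^ (1 - 2 * ρ))) :
    ∀ r ∈ Set.Ioc 0 r₀, ENNReal.ofReal (r ^ (2 * ρ)) * cknA r (t₀, x₀) v ≤ ENNReal.ofReal B := by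
  intro r hr
  have hr0 : 0 < r := hr.1
  have hsup : cknA r (t₀, x₀) v ≤ (ENNReal.ofReal r)⁻¹ * ENNReal.ofReal (B * r ^ (1 - 2 * ρ)) := by
    unfold cknA
    exact iSup₂_le fun t ht => mul_le_mul_right (hwin r hr t ht) _
  calc ENNReal.ofReal (r ^ (2 * ρ)) * cknA r (t₀, x₀) v
      ≤ ENNReal.ofReal (r ^ (2 * ρ)) * ((ENNReal.ofReal r)⁻¹ * ENNReal.ofReal (B * r ^ (1 - 2 * ρ))) :=
        mul_le_mul_right hsup _
    _ = ENNReal.ofReal B := by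
        rw [← ENNReal.ofReal_inv_of_pos hr0, ← ENNReal.ofReal_mul (by positivity),
          ← ENNReal.ofReal_mul (by positivity)]
        congr 1
        have h1 : r ^ (2 * ρ) * (r⁻¹ * r ^ (1 - 2 * ρ)) = 1 := by
          rw [← Real.rpow_neg_one r, ← Real.rpow_add hr0, ← Real.rpow_add hr0,
            show 2 * ρ + (-1 + (1 - 2 * ρ)) = 0 by ring, Real.rpow_zero]
        calc r ^ (2 * ρ) * (r⁻¹ * (B * r ^ (1 - 2 * ρ))) = B * (r ^ (2 * ρ) * (r⁻¹ * r ^ (1 - 2 * ρ))) := by ring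
          _ = B := by rw [h1, mul_one]

/-- **K1 · TEMPERED ⟹ A-GAUGE.** At a tempered vertex (exponent `a`, constants `C, J`) the normalised solution
`v = ν⁻¹u(·/ν)` obeys Seregin's power-gauged energy bound `r^{2(a−1)} A(r; (νT, x₀)) ≤ ν⁻²(2J+2)C` for `r ∈ (0, r₀]`
(the terminal slice is measurable in the Leray–Hopf frame). -/
theorem aGauge_of_temperedAt {ν T : ℝ} (hν : 0 < ν)
    {u : ℝ → EuclideanSpace ℝ (Fin 3) → EuclideanSpace ℝ (Fin 3)} (hTm : AEStronglyMeasurable (u T) volume)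
    {x₀ : EuclideanSpace ℝ (Fin 3)} {a r₀ C J : ℝ} (hC : 0 ≤ C) (hJ : 0 ≤ J)
    (htemp : ∀ r ∈ Set.Ioc 0 r₀, (∫⁻ x in ball x₀ r, ‖u T x‖ₑ ^ 2 ≤ ENNReal.ofReal (C * r ^ (3 - 2 * a))) ∧
      ∀ s ∈ Set.Ioo (T - r ^ 2 / ν) T,
        ∫⁻ x in ball x₀ r, ‖u s x - u T x‖ₑ ^ 2 ≤ ENNReal.ofReal J * ∫⁻ x in ball x₀ r, ‖u T x‖ₑ ^ 2) :
    ∀ r ∈ Set.Ioc 0 r₀, ENNReal.ofReal (r ^ (2 * (a - 1))) * cknA r (ν * T, x₀) (fun s y => ν⁻¹ • u (s / ν) y) ≤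
      ENNReal.ofReal (ν⁻¹ ^ 2 * ((2 * J + 2) * C)) := by
  refine aGauge_of_window (by positivity) fun r hr t ht => ?_
  obtain ⟨henv, hjolt⟩ := htemp r hr
  have hr0 : 0 < r := hr.1
  -- the physical time `s = t/ν` lies in the last parabolic window `(T − r²/ν, T)`
  have hs : t / ν ∈ Set.Ioo (T - r ^ 2 / ν) T := by
    constructor
    · rw [lt_div_iff₀ hν, sub_mul, div_mul_cancel₀ _ hν.ne']; linarith [ht.1]
    · rw [div_lt_iff₀ hν]; linarith [ht.2]
  -- measurability of the terminal-slice integrand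
  have hg : AEMeasurable (fun x => 2 * ‖u T x‖ₑ ^ 2) (volume.restrict (ball x₀ r)) :=
    ((hTm.enorm.pow_const 2).const_mul 2).restrict
  -- pull the normalisation out
  have hpull : ∫⁻ x in ball x₀ r, ‖ν⁻¹ • u (t / ν) x‖ₑ ^ 2 =
      ENNReal.ofReal (ν⁻¹ ^ 2) * ∫⁻ x in ball x₀ r, ‖u (t / ν) x‖ₑ ^ 2 := by
    rw [← lintegral_const_mul' _ _ ENNReal.ofReal_ne_top]
    refine lintegral_congr fun x => ?_
    rw [enorm_smul, mul_pow, Real.enorm_eq_ofReal (by positivity), ENNReal.ofReal_pow (by positivity)]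
  -- the temperate bound on the physical slice
  have hslice : ∫⁻ x in ball x₀ r, ‖u (t / ν) x‖ₑ ^ 2 ≤ ENNReal.ofReal ((2 * J + 2) * (C * r ^ (3 - 2 * a))) := by
    calc ∫⁻ x in ball x₀ r, ‖u (t / ν) x‖ₑ ^ 2
        ≤ ∫⁻ x in ball x₀ r, (2 * ‖u (t / ν) x - u T x‖ₑ ^ 2 + 2 * ‖u T x‖ₑ ^ 2) :=
          lintegral_mono fun x => enorm_sq_le_two _ _
      _ = (2 * ∫⁻ x in ball x₀ r, ‖u (t / ν) x - u T x‖ₑ ^ 2) + 2 * ∫⁻ x in ball x₀ r, ‖u T x‖ₑ ^ 2 := by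
          rw [lintegral_add_right' _ hg, lintegral_const_mul' 2 _ ENNReal.ofNat_ne_top,
            lintegral_const_mul' 2 _ ENNReal.ofNat_ne_top]
      _ ≤ 2 * (ENNReal.ofReal J * ENNReal.ofReal (C * r ^ (3 - 2 * a))) + 2 * ENNReal.ofReal (C * r ^ (3 - 2 * a)) := by
          exact add_le_add (mul_le_mul_right ((hjolt (t / ν) hs).trans (mul_le_mul_right henv _)) _)
            (mul_le_mul_right henv _)
      _ = ENNReal.ofReal ((2 * J + 2) * (C * r ^ (3 - 2 * a))) := by
          rw [show (2 * J + 2) * (C * r ^ (3 - 2 * a)) = 2 * (J * (C * r ^ (3 - 2 * a))) + 2 * (C * r ^ (3 - 2 * a)) by ring,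
            ENNReal.ofReal_add (by positivity) (by positivity), ENNReal.ofReal_mul (by norm_num : (0:ℝ) ≤ 2),
            ENNReal.ofReal_mul (by norm_num : (0:ℝ) ≤ 2), ENNReal.ofReal_mul hJ, ENNReal.ofReal_ofNat]
  calc ∫⁻ x in ball x₀ r, ‖ν⁻¹ • u (t / ν) x‖ₑ ^ 2
      = ENNReal.ofReal (ν⁻¹ ^ 2) * ∫⁻ x in ball x₀ r, ‖u (t / ν) x‖ₑ ^ 2 := hpull
    _ ≤ ENNReal.ofReal (ν⁻¹ ^ 2) * ENNReal.ofReal ((2 * J + 2) * (C * r ^ (3 - 2 * a))) := mul_le_mul_right hslice _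
    _ = ENNReal.ofReal (ν⁻¹ ^ 2 * ((2 * J + 2) * C) * r ^ (1 - 2 * (a - 1))) := by
        rw [← ENNReal.ofReal_mul (by positivity), show (1 - 2 * (a - 1)) = 3 - 2 * a by ring]
        ring_nf

/-- **Hölder on balls + Haar scaling**: an `L²`-floor `L ≤ ∫_{B_R(x₀)} ‖g‖²` forces the cubic floor
`L^{3/2} ≤ (∫_{B_R} ‖g‖³) · R^{3/2} · |B₁|^{1/2}` (`∫ fg ≤ ‖f‖_{3/2} ‖g‖₃` with `g ≡ 1`, `|B_R| = R³|B₁|`). [folklore] -/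
theorem lintegral_sq_holder_ball (x₀ : EuclideanSpace ℝ (Fin 3)) {R : ℝ} (hR : 0 < R)
    {g : EuclideanSpace ℝ (Fin 3) → EuclideanSpace ℝ (Fin 3)}
    (hg : AEMeasurable (fun x => ‖g x‖ₑ ^ 2) (volume.restrict (ball x₀ R))) {L : ℝ} (hL : 0 ≤ L)
    (h2 : ENNReal.ofReal L ≤ ∫⁻ x in ball x₀ R, ‖g x‖ₑ ^ 2) :
    ENNReal.ofReal (L ^ (3 / 2 : ℝ)) ≤ (∫⁻ x in ball x₀ R, ‖g x‖ₑ ^ (3 : ℕ)) *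
      (ENNReal.ofReal (R ^ (3 / 2 : ℝ)) * (volume (ball (0 : EuclideanSpace ℝ (Fin 3)) 1)) ^ (1 / 2 : ℝ)) := by
  have hpq : (3 / 2 : ℝ).HolderConjugate 3 := by rw [Real.holderConjugate_iff]; norm_num
  have hH := ENNReal.lintegral_mul_le_Lp_mul_Lq (volume.restrict (ball x₀ R)) hpq hg
    (aemeasurable_const (b := (1 : ℝ≥0∞)))
  simp only [Pi.mul_apply, mul_one] at hH
  have hfp : ∫⁻ x in ball x₀ R, (‖g x‖ₑ ^ 2) ^ (3 / 2 : ℝ) = ∫⁻ x in ball x₀ R, ‖g x‖ₑ ^ (3 : ℕ) := by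
    refine lintegral_congr fun x => ?_
    rw [← ENNReal.rpow_two, ← ENNReal.rpow_mul, show (2 : ℝ) * (3 / 2) = ((3 : ℕ) : ℝ) by norm_num,
      ENNReal.rpow_natCast]
  have hg1 : ∫⁻ x in ball x₀ R, (1 : ℝ≥0∞) ^ (3 : ℝ) = volume (ball x₀ R) := by simp
  have hV : volume (ball x₀ R) = ENNReal.ofReal (R ^ 3) * volume (ball (0 : EuclideanSpace ℝ (Fin 3)) 1) := by
    rw [Measure.addHaar_ball_of_pos volume x₀ hR, finrank_euclideanSpace_fin]
  have hH' : ENNReal.ofReal L ≤ (∫⁻ x in ball x₀ R, ‖g x‖ₑ ^ (3 : ℕ)) ^ (1 / (3 / 2 : ℝ)) *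
      (volume (ball x₀ R)) ^ (1 / (3 : ℝ)) := by
    rw [hfp, hg1] at hH
    exact h2.trans hH
  have h32 := ENNReal.rpow_le_rpow hH' (by norm_num : (0 : ℝ) ≤ 3 / 2)
  rw [ENNReal.mul_rpow_of_nonneg _ _ (by norm_num), ← ENNReal.rpow_mul, ← ENNReal.rpow_mul,
    show 1 / (3 / 2 : ℝ) * (3 / 2) = 1 by norm_num, ENNReal.rpow_one,
    show 1 / (3 : ℝ) * (3 / 2) = 1 / 2 by norm_num, ENNReal.ofReal_rpow_of_nonneg hL (by norm_num)] at h32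
  have hVhalf : (volume (ball x₀ R)) ^ (1 / 2 : ℝ) =
      ENNReal.ofReal (R ^ (3 / 2 : ℝ)) * (volume (ball (0 : EuclideanSpace ℝ (Fin 3)) 1)) ^ (1 / 2 : ℝ) := by
    rw [hV, ENNReal.mul_rpow_of_nonneg _ _ (by norm_num), ENNReal.ofReal_rpow_of_nonneg (by positivity) (by norm_num),
      ← Real.rpow_natCast, ← Real.rpow_mul hR.le]
    norm_num
  rwa [hVhalf] at h32

/-- **K2 · FLOORED ⟹ SEREGIN'S CUBIC FLOOR (3.1).** Along a floored scar sequence (exponent `a > 1`, floor `c`,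
non-evacuation `η`) of a classical solution on `[0, T)`, the normalised solution `v = ν⁻¹u(·/ν)` keeps the singular floor
`r^{2ρ−2} ∫∫_{(νT − r^{2+ρ}, νT) × B_r(x₀)} |v|³ ≥ ε₀` along radii `r ↓ 0`, `ρ = a − 1`, with
`ε₀ = (ν⁻² η c)^{3/2} / |B₁|^{1/2}` (Hölder on balls, Tonelli on the advective window, Haar scaling). -/
theorem cubicFloor_of_flooredAlong {ν T : ℝ} (hν : 0 < ν) (hT : 0 < T)
    {u : ℝ → EuclideanSpace ℝ (Fin 3) → EuclideanSpace ℝ (Fin 3)} {p : ℝ → EuclideanSpace ℝ (Fin 3) → ℝ}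
    (hmax : IsMaximalSmoothSolution ν 0 u p T) {x₀ : EuclideanSpace ℝ (Fin 3)} {r : ℕ → ℝ} {a c η : ℝ}
    (hpos : ∀ k, 0 < r k) (hlim : Tendsto r atTop (𝓝 0)) (ha : 1 < a) (hc : 0 < c) (hη : 0 < η)
    (hfl : ∀ k : ℕ, ENNReal.ofReal (c * r k ^ (3 - 2 * a)) ≤ ∫⁻ x in ball x₀ (r k), ‖u T x‖ₑ ^ 2 ∧
      ∀ s ∈ Set.Ioo (T - r k ^ (1 + a) / ν) T,
        ENNReal.ofReal η * ∫⁻ x in ball x₀ (r k), ‖u T x‖ₑ ^ 2 ≤ ∫⁻ x in ball x₀ (r k), ‖u s x‖ₑ ^ 2) :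
    ∃ ε₀ : ℝ, 0 < ε₀ ∧ ∀ δ : ℝ, 0 < δ → ∃ r' ∈ Set.Ioo 0 δ, ENNReal.ofReal ε₀ ≤
      ENNReal.ofReal (r' ^ (2 * (a - 1) - 2)) *
        ∫⁻ w in Set.Ioo (ν * T - r' ^ (2 + (a - 1))) (ν * T) ×ˢ ball x₀ r', ‖ν⁻¹ • u (w.1 / ν) w.2‖ₑ ^ (3 : ℕ) := by
  -- the unit-ball constant `W = |B₁|^{1/2}`
  have hB0 : volume (ball (0 : EuclideanSpace ℝ (Fin 3)) 1) ≠ 0 := (measure_ball_pos volume _ one_pos).ne'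
  have hBtop : volume (ball (0 : EuclideanSpace ℝ (Fin 3)) 1) ≠ ⊤ := measure_ball_lt_top.ne
  have hW0 : (volume (ball (0 : EuclideanSpace ℝ (Fin 3)) 1)) ^ (1 / 2 : ℝ) ≠ 0 :=
    (ENNReal.rpow_pos (pos_iff_ne_zero.2 hB0) hBtop).ne'
  have hWtop : (volume (ball (0 : EuclideanSpace ℝ (Fin 3)) 1)) ^ (1 / 2 : ℝ) ≠ ⊤ :=
    ENNReal.rpow_ne_top_of_nonneg (by norm_num) hBtop
  obtain ⟨Wr, hWr, hWeq⟩ : ∃ Wr : ℝ, 0 < Wr ∧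
      (volume (ball (0 : EuclideanSpace ℝ (Fin 3)) 1)) ^ (1 / 2 : ℝ) = ENNReal.ofReal Wr :=
    ⟨_, ENNReal.toReal_pos hW0 hWtop, (ENNReal.ofReal_toReal hWtop).symm⟩
  -- continuity of the classical solution on `[0, T) × ℝ³`
  have hcont : ContinuousOn (uncurry u) (Set.Ico 0 T ×ˢ univ) := by
    have h := hmax.1.smooth_velocity
    unfold IsSmoothSpaceTimeOn at h
    exact h.continuousOn
  refine ⟨(ν⁻¹ ^ 2 * (η * c)) ^ (3 / 2 : ℝ) * Wr⁻¹, by positivity, fun δ hδ => ?_⟩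
  -- pick a radius of the sequence below `δ`, `1` and `νT`
  have hm : 0 < min δ (min 1 (ν * T)) := lt_min hδ (lt_min one_pos (mul_pos hν hT))
  obtain ⟨k, hk⟩ : ∃ k, r k < min δ (min 1 (ν * T)) := (hlim.eventually (gt_mem_nhds hm)).exists
  have hR0 : 0 < r k := hpos k
  have hRδ : r k < δ := hk.trans_le (min_le_left _ _)
  have hR1 : r k ≤ 1 := (hk.trans_le ((min_le_right _ _).trans (min_le_left _ _))).le
  have hRT : r k < ν * T := hk.trans_le ((min_le_right _ _).trans (min_le_right _ _))
  refine ⟨r k, ⟨hR0, hRδ⟩, ?_⟩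
  have hexp : (2 : ℝ) + (a - 1) = 1 + a := by ring
  have hRa : r k ^ (1 + a) ≤ r k := by
    calc r k ^ (1 + a) ≤ r k ^ (1 : ℝ) := Real.rpow_le_rpow_of_exponent_ge hR0 hR1 (by linarith)
      _ = r k := Real.rpow_one _
  obtain ⟨hfloorT, hnonevac⟩ := hfl k
  -- (S) slice bound on the advective window, in Seregin's normalised clock
  have hS : ∀ t ∈ Set.Ioo (ν * T - r k ^ (2 + (a - 1))) (ν * T),
      ENNReal.ofReal ((ν⁻¹ ^ 2 * (η * c) * r k ^ (3 - 2 * a)) ^ (3 / 2 : ℝ)) ≤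
        (∫⁻ x in ball x₀ (r k), ‖ν⁻¹ • u (t / ν) x‖ₑ ^ (3 : ℕ)) *
          (ENNReal.ofReal (r k ^ (3 / 2 : ℝ)) * (volume (ball (0 : EuclideanSpace ℝ (Fin 3)) 1)) ^ (1 / 2 : ℝ)) := by
    intro t ht
    rw [hexp] at ht
    have hs : t / ν ∈ Set.Ioo (T - r k ^ (1 + a) / ν) T := by
      constructor
      · rw [lt_div_iff₀ hν, sub_mul, div_mul_cancel₀ _ hν.ne']; linarith [ht.1]
      · rw [div_lt_iff₀ hν]; linarith [ht.2]
    have hsI : t / ν ∈ Set.Ico 0 T := by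
      refine ⟨?_, hs.2⟩
      rw [le_div_iff₀ hν]; nlinarith [ht.1, hRa.trans_lt hRT]
    have hmeas : AEMeasurable (fun x => ‖ν⁻¹ • u (t / ν) x‖ₑ ^ 2) (volume.restrict (ball x₀ (r k))) :=
      (((hmax.1.contDiff_velocity hsI).continuous.const_smul ν⁻¹).aestronglyMeasurable).enorm.pow_const 2
    have h2 : ENNReal.ofReal (ν⁻¹ ^ 2 * (η * c) * r k ^ (3 - 2 * a)) ≤
        ∫⁻ x in ball x₀ (r k), ‖ν⁻¹ • u (t / ν) x‖ₑ ^ 2 := by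
      have hpull : ∫⁻ x in ball x₀ (r k), ‖ν⁻¹ • u (t / ν) x‖ₑ ^ 2 =
          ENNReal.ofReal (ν⁻¹ ^ 2) * ∫⁻ x in ball x₀ (r k), ‖u (t / ν) x‖ₑ ^ 2 := by
        rw [← lintegral_const_mul' _ _ ENNReal.ofReal_ne_top]
        refine lintegral_congr fun x => ?_
        rw [enorm_smul, mul_pow, Real.enorm_eq_ofReal (by positivity), ENNReal.ofReal_pow (by positivity)]
      rw [hpull, show ν⁻¹ ^ 2 * (η * c) * r k ^ (3 - 2 * a) = ν⁻¹ ^ 2 * (η * (c * r k ^ (3 - 2 * a))) by ring,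
        ENNReal.ofReal_mul (by positivity), ENNReal.ofReal_mul hη.le]
      exact mul_le_mul_right ((mul_le_mul_right hfloorT _).trans (hnonevac _ hs)) _
    exact lintegral_sq_holder_ball x₀ hR0 hmeas (by positivity) h2
  -- Tonelli on the advective window × ball
  have hmeasW : AEMeasurable (fun w : ℝ × EuclideanSpace ℝ (Fin 3) => ‖ν⁻¹ • u (w.1 / ν) w.2‖ₑ ^ (3 : ℕ))
      ((volume.restrict (Set.Ioo (ν * T - r k ^ (2 + (a - 1))) (ν * T))).prod
        (volume.restrict (ball x₀ (r k)))) := by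
    rw [Measure.prod_restrict, ← Measure.volume_eq_prod]
    have hg : Continuous (fun w : ℝ × EuclideanSpace ℝ (Fin 3) => (w.1 / ν, w.2)) := by fun_prop
    have hmaps : Set.MapsTo (fun w : ℝ × EuclideanSpace ℝ (Fin 3) => (w.1 / ν, w.2))
        (Set.Ioo (ν * T - r k ^ (2 + (a - 1))) (ν * T) ×ˢ ball x₀ (r k)) (Set.Ico 0 T ×ˢ univ) := by
      intro w hw
      refine ⟨⟨?_, ?_⟩, trivial⟩
      · rw [le_div_iff₀ hν]; rw [hexp] at hw; nlinarith [hw.1.1, hRa.trans_lt hRT]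
      · rw [div_lt_iff₀ hν]; linarith [hw.1.2]
    have hc' : ContinuousOn (fun w : ℝ × EuclideanSpace ℝ (Fin 3) => ν⁻¹ • u (w.1 / ν) w.2)
        (Set.Ioo (ν * T - r k ^ (2 + (a - 1))) (ν * T) ×ˢ ball x₀ (r k)) :=
      (hcont.comp hg.continuousOn hmaps).const_smul ν⁻¹
    exact (hc'.aestronglyMeasurable (measurableSet_Ioo.prod measurableSet_ball)).enorm.pow_const _
  have hY : ∫⁻ w in Set.Ioo (ν * T - r k ^ (2 + (a - 1))) (ν * T) ×ˢ ball x₀ (r k), ‖ν⁻¹ • u (w.1 / ν) w.2‖ₑ ^ (3 : ℕ) =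
      ∫⁻ t in Set.Ioo (ν * T - r k ^ (2 + (a - 1))) (ν * T), ∫⁻ x in ball x₀ (r k), ‖ν⁻¹ • u (t / ν) x‖ₑ ^ (3 : ℕ) := by
    rw [Measure.volume_eq_prod, ← Measure.prod_restrict]
    exact lintegral_prod _ hmeasW
  have hIvol : volume (Set.Ioo (ν * T - r k ^ (2 + (a - 1))) (ν * T)) = ENNReal.ofReal (r k ^ (2 + (a - 1))) := by
    rw [Real.volume_Ioo]; congr 1; ring
  have hKtop : ENNReal.ofReal (r k ^ (3 / 2 : ℝ)) * (volume (ball (0 : EuclideanSpace ℝ (Fin 3)) 1)) ^ (1 / 2 : ℝ) ≠ ⊤ :=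
    ENNReal.mul_ne_top ENNReal.ofReal_ne_top hWtop
  -- (T) integrate the slice bound in time
  have hTint : ENNReal.ofReal ((ν⁻¹ ^ 2 * (η * c) * r k ^ (3 - 2 * a)) ^ (3 / 2 : ℝ)) *
      ENNReal.ofReal (r k ^ (2 + (a - 1))) ≤
      (∫⁻ w in Set.Ioo (ν * T - r k ^ (2 + (a - 1))) (ν * T) ×ˢ ball x₀ (r k), ‖ν⁻¹ • u (w.1 / ν) w.2‖ₑ ^ (3 : ℕ)) *
        (ENNReal.ofReal (r k ^ (3 / 2 : ℝ)) * (volume (ball (0 : EuclideanSpace ℝ (Fin 3)) 1)) ^ (1 / 2 : ℝ)) := by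
    rw [hY, ← hIvol, ← setLIntegral_const, ← lintegral_mul_const' _ _ hKtop]
    exact setLIntegral_mono' measurableSet_Ioo fun t ht => hS t ht
  -- real bookkeeping of the exponents
  have eR : ∀ p q : ℝ, r k ^ p * r k ^ q = r k ^ (p + q) := fun p q => (Real.rpow_add hR0 p q).symm
  have hpow : (ν⁻¹ ^ 2 * (η * c) * r k ^ (3 - 2 * a)) ^ (3 / 2 : ℝ) =
      (ν⁻¹ ^ 2 * (η * c)) ^ (3 / 2 : ℝ) * r k ^ ((3 - 2 * a) * (3 / 2)) := by
    rw [Real.mul_rpow (by positivity) (by positivity), ← Real.rpow_mul hR0.le]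
  have hid1 : (ν⁻¹ ^ 2 * (η * c)) ^ (3 / 2 : ℝ) * Wr⁻¹ =
      r k ^ (2 * (a - 1) - 7 / 2) * Wr⁻¹ *
        ((ν⁻¹ ^ 2 * (η * c) * r k ^ (3 - 2 * a)) ^ (3 / 2 : ℝ) * r k ^ (2 + (a - 1))) := by
    rw [hpow]
    calc (ν⁻¹ ^ 2 * (η * c)) ^ (3 / 2 : ℝ) * Wr⁻¹
        = (ν⁻¹ ^ 2 * (η * c)) ^ (3 / 2 : ℝ) * Wr⁻¹ * r k ^ ((3 - 2 * a) * (3 / 2) + (2 + (a - 1)) + (2 * (a - 1) - 7 / 2)) := by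
          rw [show (3 - 2 * a) * (3 / 2) + (2 + (a - 1)) + (2 * (a - 1) - 7 / 2) = (0 : ℝ) by ring, Real.rpow_zero, mul_one]
      _ = r k ^ (2 * (a - 1) - 7 / 2) * Wr⁻¹ *
          ((ν⁻¹ ^ 2 * (η * c)) ^ (3 / 2 : ℝ) * r k ^ ((3 - 2 * a) * (3 / 2)) * r k ^ (2 + (a - 1))) := by
          rw [← eR, ← eR]; ring
  have hid2 : r k ^ (2 * (a - 1) - 7 / 2) * Wr⁻¹ * (r k ^ (3 / 2 : ℝ) * Wr) = r k ^ (2 * (a - 1) - 2) := by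
    calc r k ^ (2 * (a - 1) - 7 / 2) * Wr⁻¹ * (r k ^ (3 / 2 : ℝ) * Wr)
        = r k ^ (2 * (a - 1) - 7 / 2) * r k ^ (3 / 2 : ℝ) * (Wr⁻¹ * Wr) := by ring
      _ = r k ^ (2 * (a - 1) - 2) := by
          rw [inv_mul_cancel₀ hWr.ne', mul_one, eR, show 2 * (a - 1) - 7 / 2 + 3 / 2 = 2 * (a - 1) - 2 by ring]
  -- assemble
  calc ENNReal.ofReal ((ν⁻¹ ^ 2 * (η * c)) ^ (3 / 2 : ℝ) * Wr⁻¹)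
      = ENNReal.ofReal (r k ^ (2 * (a - 1) - 7 / 2) * Wr⁻¹) *
          (ENNReal.ofReal ((ν⁻¹ ^ 2 * (η * c) * r k ^ (3 - 2 * a)) ^ (3 / 2 : ℝ)) *
            ENNReal.ofReal (r k ^ (2 + (a - 1)))) := by
        rw [← ENNReal.ofReal_mul (by positivity), ← ENNReal.ofReal_mul (by positivity), hid1]
    _ ≤ ENNReal.ofReal (r k ^ (2 * (a - 1) - 7 / 2) * Wr⁻¹) *
          ((∫⁻ w in Set.Ioo (ν * T - r k ^ (2 + (a - 1))) (ν * T) ×ˢ ball x₀ (r k), ‖ν⁻¹ • u (w.1 / ν) w.2‖ₑ ^ (3 : ℕ)) *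
            (ENNReal.ofReal (r k ^ (3 / 2 : ℝ)) * (volume (ball (0 : EuclideanSpace ℝ (Fin 3)) 1)) ^ (1 / 2 : ℝ))) :=
        mul_le_mul_right hTint _
    _ = ENNReal.ofReal (r k ^ (2 * (a - 1) - 7 / 2) * Wr⁻¹) *
          (ENNReal.ofReal (r k ^ (3 / 2 : ℝ)) * (volume (ball (0 : EuclideanSpace ℝ (Fin 3)) 1)) ^ (1 / 2 : ℝ)) *
          ∫⁻ w in Set.Ioo (ν * T - r k ^ (2 + (a - 1))) (ν * T) ×ˢ ball x₀ (r k), ‖ν⁻¹ • u (w.1 / ν) w.2‖ₑ ^ (3 : ℕ) := by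
        ring
    _ = ENNReal.ofReal (r k ^ (2 * (a - 1) - 2)) *
          ∫⁻ w in Set.Ioo (ν * T - r k ^ (2 + (a - 1))) (ν * T) ×ˢ ball x₀ (r k), ‖ν⁻¹ • u (w.1 / ν) w.2‖ₑ ^ (3 : ℕ) := by
        rw [hWeq, ← ENNReal.ofReal_mul (by positivity), ← ENNReal.ofReal_mul (by positivity), hid2]


/-! ## The engine kill (lens §6 K4), stated on the TREE item -/

/-- **Item 33329 `EngineKillsConicalJolt` PROVED** (K4): `X_E → GX → LJᶜ` — at a tame-conical jolting skirt vertex K1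
supplies Seregin's A-gauge and K2 the cubic floor at the skirt's own gauge `ρ = a − 1 ∈ (0, 1/2]`, GX the suitability and the
E- and D-gauges; `sereginZoomReduction_proof` rescales to a member of X_E's class that is not a.e. zero, contradicting X_E. -/
theorem rootDecompStaticSkirt_engineKillsConicalJolt_proof :
    Summit.NavierStokesRegularity.NavierStokesRegularity.Theses.RootDecompStaticSkirt.EngineKillsConicalJolt := by
  intro hXE hGX ν T hν hT u p hmax hLH hdec htend x₀ r hs hj htc
  obtain ⟨a, r₀, C, J, c, η, ha1, ha2, hr₀, hC, hJ, hc, hη, htemp, hfloor⟩ := htc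
  have hTm : AEStronglyMeasurable (u T) volume := (hLH.memLp T ⟨hT.le, le_rfl⟩).aestronglyMeasurable
  have hA := aGauge_of_temperedAt hν hTm hC hJ htemp
  obtain ⟨q, G, r₁, M, hr₁, hsg, hED⟩ :=
    hGX ν T hν hT u p hmax hLH hdec htend x₀ r a r₀ C J c η hs hj ha1 ha2 hr₀ hC hJ hc hη htemp hfloor
  have hfl := cubicFloor_of_flooredAlong hν hT hmax hs.1 hs.2.1 ha1 hc hη hfloor
  have hρ : 0 < a - 1 := by linarith
  have hρ' : a - 1 ≤ 1 / 2 := by linarith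
  have hmin : 0 < min r₀ r₁ := lt_min hr₀ hr₁
  obtain ⟨hsw, hgrad⟩ := hsg (min r₀ r₁) ⟨hmin, min_le_right _ _⟩
  have hM : ∃ M' : NNReal, ∀ ρ ∈ Set.Ioc 0 (min r₀ r₁),
      ENNReal.ofReal (ρ ^ (2 * (a - 1))) * cknA ρ (ν * T, x₀) (fun s y => ν⁻¹ • u (s / ν) y) +
        ENNReal.ofReal (ρ ^ (a - 1)) * cknE ρ (ν * T, x₀) G +
        ENNReal.ofReal (ρ ^ (2 * (a - 1))) * cknD ρ (ν * T, x₀) q ≤ (M' : ENNReal) := by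
    refine ⟨Real.toNNReal (ν⁻¹ ^ 2 * ((2 * J + 2) * C)) + M, fun ρ hρm => ?_⟩
    have h1 := hA ρ ⟨hρm.1, hρm.2.trans (min_le_left _ _)⟩
    have h2 := hED ρ ⟨hρm.1, hρm.2.trans (min_le_right _ _)⟩
    rw [add_assoc, ENNReal.coe_add]
    exact add_le_add h1 h2
  obtain ⟨U, P, H, c', hU, hH, hclass, hne⟩ :=
    Theorems.SereginZoomReduction.sereginZoomReduction_proof (a - 1) hρ hρ' (min r₀ r₁) (ν * T, x₀)
      (fun s y => ν⁻¹ • u (s / ν) y) q G hmin hsw hgrad hM hfl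
  exact hne (hXE (a - 1) hρ U P H c' hU hH hclass)

end Summit.NavierStokesRegularity.NavierStokesRegularity.Theorems.RootDecompStaticSkirtEngineKill
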